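import Summits.ValiantsHypothesis.ValiantsHypothesis.Theorems.KPlusLogSqLawTropicalSymmetricThreeFourFloor
import Summits.ValiantsHypothesis.ValiantsHypothesis.Theorems.KPlusLogSqLawTropicalOrbitDominance

/-!
# Route «KPlusLogSqLaw» — the symmetric single-term `(3,4)` tropical row in the row vocabulary: KERNEL WINDOW `[15, 18]`

HONEST FRAMING.  Helper file (seat val-sym-lift-p2 (g5), cell `pub-symmetroid`, 2026-08-27; `--supports` the `WeakLifting` item
stmt-ValiantsHypothesis-19561 as a helper, no closure claim).  Bookkeeping only: it restates the two kernel bounds of record for the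
symmetric SINGLE-TERM `(3,4)` tropical row — the ceiling `tropRow_three_four_symm_le` (p459728, `n ≤ 18` on every support) and the floor
`fifteen_le_of_symm_bound` (p469079, `15` attained on `(0,1,4,13)`) — in the row predicate `TropicalCensus.Orbit.TropRootLawAtSymm` landed
meanwhile (p473280), so that the kernel window can be cited as one pair of declarations: `TropRootLawAtSymm 3 4 18 ∧ ¬ TropRootLawAtSymm 3 4 14`,
i.e. `15 ≤ T^single_sym(3,4) ≤ 18` in the kernel (cell level: `= 15`, two codes — theory-2 g19's σ-state DP and this seat's pairwise DP; the
port of the ceiling `15` is OPEN).  A tropical single-term row bounds no real pencil; nothing here bears on `TropicalB` / `WeakLifting` in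
their windows, the real census (DoorA34 = `PosRootLawAt 3 4 18`, OPEN, never asserted), `MatrixDescartes` (stmt-ValiantsHypothesis-18050) or
VP ≠ VNP.
-/

-- `Summit.ValiantsHypothesis.ValiantsHypothesis.…` repeats a component by the D-0017 layout
-- (single-conjunct summit), which the `dupNamespace` linter flags; the name is mandated.
set_option linter.dupNamespace false
set_option autoImplicit false

namespace Summit.ValiantsHypothesis.ValiantsHypothesis.Theorems.KPlusLogSqLaw

open Summit.ValiantsHypothesis.ValiantsHypothesis.Theorems.LacunarySymmetroidMatrixDescartes.TropicalCensus.Orbit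

/-- **Ceiling of record in the row vocabulary**: `TropRootLawAtSymm 3 4 18` — every sign-alternating chain of uniquely dominant terms
of a symmetric `3 × 3` four-class design has at most `18` alternations (lift-p2 g4's `tropRow_three_four_symm_le`, restated).
[p459728, restated] -/
theorem tropRootLawAtSymm_three_four_eighteen : TropRootLawAtSymm 3 4 18 :=
  fun d v ε hv hε n θ p hθ hdom halt => tropRow_three_four_symm_le d v ε hv hε n θ p hθ hdom halt

/-- **Floor of record in the row vocabulary**: every `B` with `TropRootLawAtSymm 3 4 B` has `15 ≤ B` (the `(0,1,4,13)` design of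
`SymmetricThreeFourFloor.exists_chain`). [p469079, restated] -/
theorem fifteen_le_of_tropRootLawAtSymm {B : ℕ} (h : TropRootLawAtSymm 3 4 B) : 15 ≤ B :=
  fifteen_le_of_symm_bound h

/-- `¬ TropRootLawAtSymm 3 4 14`. [p469079, restated] -/
theorem not_tropRootLawAtSymm_three_four_fourteen : ¬ TropRootLawAtSymm 3 4 14 :=
  fun h => absurd (fifteen_le_of_tropRootLawAtSymm h) (by norm_num)

/-- **The kernel window for the symmetric single-term `(3,4)` tropical row: `[15, 18]`** — `TropRootLawAtSymm 3 4 18` holds and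
`TropRootLawAtSymm 3 4 14` fails; the least admissible `B` lies in `{15, 16, 17, 18}` (cell level: `15`). [p459728 + p469079] -/
theorem tropRootLawAtSymm_three_four_window : TropRootLawAtSymm 3 4 18 ∧ ¬ TropRootLawAtSymm 3 4 14 :=
  ⟨tropRootLawAtSymm_three_four_eighteen, not_tropRootLawAtSymm_three_four_fourteen⟩

/-- the same window for the ORBIT-model row on the floor side: an orbit row `TropRootLawAtSymmOrb 3 4 B` bounds the single-term row
(`tropRootLawAtSymm_of_orb`), hence also `15 ≤ B`; in particular `¬ TropRootLawAtSymmOrb 3 4 14`.  (The orbit targets `TSymOrb34Le17` /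
`TSymOrb34Le16` of p473280 are untouched.) [p469079 + p473280] -/
theorem fifteen_le_of_tropRootLawAtSymmOrb {B : ℕ} (h : TropRootLawAtSymmOrb 3 4 B) : 15 ≤ B :=
  fifteen_le_of_tropRootLawAtSymm (tropRootLawAtSymm_of_orb h)

end Summit.ValiantsHypothesis.ValiantsHypothesis.Theorems.KPlusLogSqLaw
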